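import Literature.MathematicalPhysics.QuantumFieldTheory.King1986.EffectiveLaplacianSymbol
import Literature.MathematicalPhysics.QuantumFieldTheory.Balaban1983to89.B4Sect5Torus
import Literature.MathematicalPhysics.QuantumFieldTheory.Balaban1983to89.Beta.CombesThomasForm

/-!
# Uniform exponential decay at `A = 0` on the torus: Dimock's Lemmas 29–30 (the averaging lower bound and the
# conjugated-operator decay of `G_k`) in King's normalisation, and the decay of King's effective Laplacian `Δ^{(k)}`

CITATION HEADER.  This module reproduces, kernel-checked and with explicit constants, two printed-and-proved lemmas of
J. Dimock, *The renormalization group according to Balaban. I. Small fields*, Rev. Math. Phys. **25** (2013) 1330010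
= arXiv:1108.1335v2 [bib `Dimock2013`], Appendix D (arXiv TeX lines 3607–3745):
* **Lemma 29** (`\label{twentynine}`): *"The following holds for a constant c₀ = O(1). 1. For a unit cube Δ, as
  operators on L²(Δ): [−Δ + μ̄_k + a_kQ_k^TQ_k]_Δ ≥ c₀(−Δ + I). 2. For Ω a union of M cubes, as operators on L²(Ω):
  [−Δ + μ̄_k + a_kQ_k^TQ_k]_Ω ≥ c₀(−Δ + I)"* — *"The idea is that the averaging operator a_kQ_k^TQ_k supplies an
  effective mass. The parameter μ̄_k … is generally tiny and cannot help with this uniform bound."*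
* **Lemma 30** (`\label{thirty}`): *"Let supp f ⊂ Δ_y, supp f′ ⊂ Δ_{y′} with Δ_y, Δ_{y′} ⊂ Ω. Then with δ₀ = O(1) we
  have |⟨f, G_k(Ω)f′⟩| ≤ O(1)e^{−δ₀d(y,y′)}‖f‖₂‖f′‖₂"*, proved through the conjugated operator
  *"𝒟_q ≡ e_{−q}[−Δ + μ̄_k + a_kQ_k^TQ_k]_Ω e_q"*, the form estimate *"|⟨f,[𝒟_q − 𝒟_0]f⟩| ≤ c₁|q|⟨f,(−Δ+I)f⟩"* (city1),
  *"|⟨f, 𝒟_q f⟩| ≥ ½c₀⟨f,(−Δ+I)f⟩ ≥ ½c₀‖f‖₂²"* (city2), *"‖𝒟_q⁻¹h‖₂ ≤ 2c₀⁻¹‖h‖"*, and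
  *"|⟨f, G_k(Ω)f′⟩| = |⟨e_qf, [e_{−q}G_k(Ω)e_q]e_{−q}f′⟩| ≤ O(1)‖e_qf‖‖e_{−q}f′‖ ≤ O(1)e^{q·(y−y′)}"* (usher1.5),
  followed by Dimock's *"Δ_k(Ω) = a_k − a_k²Q_kG_k(Ω)Q_k^T … Since A_k, Q_k are local operators, it follows that the
  kernel … satisfies |C_k(Ω; y,y′)| ≤ O(1)L²e^{−δ₀L^{−2}d(y,y′)}"* (coin)/(Cbound),
and applies them to the A = 0 objects of C. King, *The U(1) Higgs model. I. The continuum limit*, Commun. Math. Phys.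
**102** (1986) 649–677 [bib `King1986`]: the unit-lattice effective Laplacian `Δ^{(k)} = a_kI − a_k²Q_kG_kQ_k^*` (2.14)
p.653 of the sibling module `EffectiveLaplacianSymbol` (`Torus.effLaplacian`), whose *"uniform exponential decay (see
Theorem 3.3)"* King USES on p.674–675 ((4.34)(ii), proof of Lemma 4.5) and takes from [Ba 4] = T. Bałaban, Commun.
Math. Phys. **89** (1983) 571–597.  Dimock proves these statements for the scalar `N`-component model with Neumann
boundary conditions on unions of cubes; HERE: periodic boundary conditions (a torus), flat block profile, King's
normalisation `A₀ = N²(−Δ) + m² + a·Q*Q` on the fine torus `Π ℤ/(NM_μ)` (`N = L^k`), `Q*Q = blockProj` the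
`N`-block-mean projector.  Nothing printed in Bałaban's papers is certified thereby; the manuscripts under audit in the
cell `pub-balaban` (B4–B16) are not quoted for any step.  VALUE = kernel reproduction of a printed A = 0 estimate
(the one place in King's §4 K5 chain that was delegated to [Ba 4]), NOT summit progress (UV stability ≠ continuum
limit ≠ Clay problem).

MAIN RESULTS (all PROVED, 0 sorry; namespace `…King1986` / `…King1986.Torus`).
* §1 (abstract, any finite index set; vocabulary `QGQInverse.conj`/`Coercive` of the cell's finite Combes–Thomas
  module): `form_conj_eq_cosh` / `form_conj_sub_eq` — for SYMMETRIC `S` the form of the conjugated matrix has `cosh`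
  weights (the first-order, antisymmetric part of the conjugation error cancels — this is why Dimock's (city1) is
  available with bond coefficients `η⁻²`); `abs_form_conj_sub_le` (Schur on the `cosh − 1` weights),
  `coercive_conj_of_symm` (= (city2)), `inv_apply_eq_conj` / `dot_inv_mulVec_eq_conj` (`S⁻¹ = e^{−f}S_f⁻¹e^{f}`),
  `abs_dot_inv_mulVec_le` (`|⟨v,T⁻¹w⟩| ≤ γ⁻¹‖v‖‖w‖`), and **`abs_dot_inv_le_of_conj`** = Lemma 30 in abstract form:
  `|⟨v, S⁻¹w⟩| ≤ (γ − ρ)⁻¹‖e^{−f}v‖‖e^{f}w‖`.  (The ENTRYWISE form version of Combes–Thomas is the β lineage's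
  `Beta.CombesThomasForm.combesThomas_form`/`combesThomas_lattice`, whose `inv_sq_mul_cosh_sub_one_le` is reused here;
  the Schur/`e^{κd} − 1` version is `QGQInverse.inverse_decay` — for the fine operator the latter loses a factor `N`,
  the bilinear block version is what gives `N`-uniform constants WITH the block normalisation `N^{−d}`.)
* §2 `tdistT` — the sup-circular torus distance on `Tor K = Π ℤ/K_μ` (pulled back from `B4Sect5Torus.tdist`; pseudo-
  distance, uniform lattice sums `tdistT_sumBound` with `B4Sect5Proof.latticeConst`, nearest neighbours at distance
  `≤ 1`); §2b block geometry: sites of one `N`-block are within `N − 1` (`tdistT_site_site_le`,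
  `tdistT_le_of_blockOf_eq`) and `N·tdist(b,b′) ≤ tdist(x,x′) + (N − 1)` for `x ∈ B(b)`, `x′ ∈ B(b′)`
  (`mul_tdistT_blocks_le`).
* §3 **LEMMA 29 ON THE TORUS** `fineOp_coercive_unif`: `⟨ψ, A₀ψ⟩ ≥ γ_A‖ψ‖²`, `γ_A = gamA a d = min(4c₀/(c₀+4),
  a c₀/4)`, `c₀ = (4/π²)^d`, for ALL `N ≥ 1`, all tori, all `m² ≥ 0` (fibre/Bloch decomposition `TorusBlockForm.
  form_decomp` + `EndpointCoercivity.fibre_coercive` with the off-centre symbol bound `lapSym_ge_four_of_off_centre`).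
* §3b second-order defects: `lapF_coshRow_le`, `blockProj_coshRow_le`, and `fineOp_coshRow_le` — with the weight
  `ctW = (κ/N)·tdist(·, x₀)` the `cosh`-row sums of `A₀` are `≤ (2d + a)κ²`, NO `N` (= (city1) in kernel form).
* §4 **LEMMA 30 ON THE TORUS** `fineOp_inv_sandwich_decay`: `|(QA₀⁻¹Qᵀ)(b,b′)| ≤ (γ_A − (2d+a)κ²)⁻¹N^{−d}e^{2κ}
  e^{−κ·tdist(b,b′)}`; **`effLaplacian_entry_le`**, **`effLaplacian_decay`**: `|Δ^{(k)}(b,b′)| ≤ C_Δ(a,d)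
  e^{−κ_A(a,d)·tdist(b,b′)}` with `kapA = min(1, √(γ_A/(2(2d+a))))`, `CDelta = a + a²(2/γ_A)e²` — King's (4.34)(ii)
  for `Δ^{(k)}` as a THEOREM, constants depending on `a, d` only.

SCOPE / NOT COVERED (say it plainly).  A = 0 and PERIODIC boundary conditions only; `m² ≥ 0` arbitrary (the decay
does not use the mass — Dimock's remark on `μ̄_k`); flat block profile; the rate `κ_A` is not optimised (Dimock/King
state `O(1)`); nothing about free boundary conditions / multiple reflections ([Ba 4]), background fields, the
vector-field operators, the pointwise (`L^∞`, short-distance) bounds of Dimock's (sycamore3) or B4's Theorem, or the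
position-space Props 3.8/3.9 of King.  The consumer is the sibling `CovarianceRateTorus` (King's Lemma 4.5 assembled).

## References
* [Dimock2013] J. Dimock, *The renormalization group according to Balaban. I. Small fields*, Rev. Math. Phys. 25
  (2013) 1330010, arXiv:1108.1335v2 — App. D, Lemma 29 (twentynine), Lemma 30 (thirty), (city1), (city2), (usher1.5),
  (coin), (Cbound).
* [King1986] C. King, Commun. Math. Phys. 102 (1986) 649–677 — (2.13)–(2.14) p.653, (4.33)–(4.34) p.674, Lemma 4.5.
* [Balaban1983RegularityDecay] T. Bałaban, Commun. Math. Phys. 89 (1983) 571–597 — King's [Ba 4] (context only).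
-/

noncomputable section

open Finset Real Matrix
open scoped BigOperators ComplexConjugate

namespace Literature.MathematicalPhysics.QuantumFieldTheory.King1986

open Literature.MathematicalPhysics.QuantumFieldTheory.Balaban1983to89
open Literature.MathematicalPhysics.QuantumFieldTheory.Balaban1983to89.B5Prop11Plancherel

/-! ## §1 Combes–Thomas in quadratic-form version, BILINEAR (block-to-block) conclusion — Dimock's Lemma 30 (2.) -/

section FormCT

variable {n : Type*} [Fintype n] [DecidableEq n]

open QGQInverse

omit [DecidableEq n] in
/-- For a SYMMETRIC real matrix the quadratic form of the conjugated matrix `S_f = e^{f}Se^{−f}` symmetrises to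
`cosh` weights: `⟨x, S_f x⟩ = Σ_{a,b} cosh(f a − f b) S(a,b) x_a x_b` — the first-order (antisymmetric, `sinh`) part of
the conjugation error drops out of the form.  Dimock: *"also written as ⟨∂_{−q}f, ∂_q f⟩ − ⟨∂f, ∂f⟩"*.
[cite: Dimock2013, App. D, proof of Lemma 30 (1.), arXiv:1108.1335v2] [folklore] -/
theorem form_conj_eq_cosh (S : Matrix n n ℝ) (hS : ∀ a b, S b a = S a b) (f : n → ℝ) (x : n → ℝ) :
    x ⬝ᵥ (QGQInverse.conj f S *ᵥ x) = ∑ a, ∑ b, Real.cosh (f a - f b) * S a b * x a * x b := by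
  have h1 : x ⬝ᵥ (QGQInverse.conj f S *ᵥ x) = ∑ a, ∑ b, Real.exp (f a - f b) * S a b * x a * x b := by
    simp only [dotProduct, Matrix.mulVec, conj_apply, Finset.mul_sum]
    exact Finset.sum_congr rfl fun a _ => Finset.sum_congr rfl fun b _ => by ring
  have h2 : ∑ a, ∑ b, Real.exp (f a - f b) * S a b * x a * x b
      = ∑ a, ∑ b, Real.exp (f b - f a) * S a b * x a * x b := by
    rw [Finset.sum_comm]
    refine Finset.sum_congr rfl fun a _ => Finset.sum_congr rfl fun b _ => ?_
    rw [hS a b]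
    ring
  calc x ⬝ᵥ (QGQInverse.conj f S *ᵥ x)
      = (1 / 2) * (∑ a, ∑ b, Real.exp (f a - f b) * S a b * x a * x b
          + ∑ a, ∑ b, Real.exp (f b - f a) * S a b * x a * x b) := by rw [h1, ← h2]; ring
    _ = ∑ a, ∑ b, Real.cosh (f a - f b) * S a b * x a * x b := by
        rw [← Finset.sum_add_distrib, Finset.mul_sum]
        refine Finset.sum_congr rfl fun a _ => ?_
        rw [← Finset.sum_add_distrib, Finset.mul_sum]
        refine Finset.sum_congr rfl fun b _ => ?_
        rw [Real.cosh_eq, show f b - f a = -(f a - f b) by ring]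
        ring

omit [DecidableEq n] in
/-- The conjugation ERROR of a symmetric matrix in form sense: `⟨x, (S_f − S)x⟩ = Σ_{a,b} (cosh(f a − f b) − 1) S(a,b) x_a x_b`.
[cite: Dimock2013, App. D, (city1) in the proof of Lemma 30] [folklore] -/
theorem form_conj_sub_eq (S : Matrix n n ℝ) (hS : ∀ a b, S b a = S a b) (f : n → ℝ) (x : n → ℝ) :
    x ⬝ᵥ ((QGQInverse.conj f S - S) *ᵥ x) = ∑ a, ∑ b, (Real.cosh (f a - f b) - 1) * S a b * x a * x b := by
  rw [Matrix.sub_mulVec, dotProduct_sub, form_conj_eq_cosh S hS f x]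
  have h0 : x ⬝ᵥ (S *ᵥ x) = ∑ a, ∑ b, S a b * x a * x b := by
    simp only [dotProduct, Matrix.mulVec, Finset.mul_sum]
    exact Finset.sum_congr rfl fun a _ => Finset.sum_congr rfl fun b _ => by ring
  rw [h0, ← Finset.sum_sub_distrib]
  refine Finset.sum_congr rfl fun a _ => ?_
  rw [← Finset.sum_sub_distrib]
  exact Finset.sum_congr rfl fun b _ => by ring

omit [DecidableEq n] in
/-- **Schur bound on the symmetrised conjugation error.**  If the `cosh`-weighted absolute ROW sums
`Σ_b |S(a,b)| (cosh(f a − f b) − 1)` are `≤ ρ`, then `|⟨x, (S_f − S)x⟩| ≤ ρ‖x‖²` (columns follow by symmetry of `S`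
and evenness of `cosh`).  [cite: Dimock2013, App. D, (city1): "|⟨f,[D_q − D_0]f⟩| ≤ c₁|q|⟨f,(−Δ+I)f⟩"] [folklore] -/
theorem abs_form_conj_sub_le (S : Matrix n n ℝ) (hS : ∀ a b, S b a = S a b) (f : n → ℝ) {ρ : ℝ}
    (hρ : 0 ≤ ρ) (hrow : ∀ a, ∑ b, |S a b| * (Real.cosh (f a - f b) - 1) ≤ ρ) (x : n → ℝ) :
    |x ⬝ᵥ ((QGQInverse.conj f S - S) *ᵥ x)| ≤ ρ * (x ⬝ᵥ x) := by
  set E : Matrix n n ℝ := Matrix.of fun a b => (Real.cosh (f a - f b) - 1) * S a b with hEdef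
  have hE : x ⬝ᵥ ((QGQInverse.conj f S - S) *ᵥ x) = x ⬝ᵥ (E *ᵥ x) := by
    rw [form_conj_sub_eq S hS f x]
    simp only [dotProduct, Matrix.mulVec, hEdef, Matrix.of_apply, Finset.mul_sum]
    exact Finset.sum_congr rfl fun a _ => Finset.sum_congr rfl fun b _ => by ring
  have habs : ∀ a b, |E a b| = |S a b| * (Real.cosh (f a - f b) - 1) := by
    intro a b
    simp only [hEdef, Matrix.of_apply]
    rw [abs_mul, abs_of_nonneg (by linarith [Real.one_le_cosh (f a - f b)]), mul_comm]
  have hR : ∀ a, ∑ b, |E a b| ≤ ρ := fun a => by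
    simp_rw [habs]
    exact hrow a
  have hC : ∀ b, ∑ a, |E a b| ≤ ρ := fun b => by
    simp_rw [habs]
    calc ∑ a, |S a b| * (Real.cosh (f a - f b) - 1)
        = ∑ a, |S b a| * (Real.cosh (f b - f a) - 1) := by
          refine Finset.sum_congr rfl fun a _ => ?_
          rw [hS b a, show f a - f b = -(f b - f a) by ring, Real.cosh_neg]
      _ ≤ ρ := hrow b
  rw [hE]
  exact form_abs_le_of_schur E hρ (le_of_eq (by ring)) hR hC x

omit [DecidableEq n] in
/-- **Coercivity of the conjugated operator** (Dimock's (city2): `|⟨f, D_q f⟩| ≥ ½c₀‖f‖²` for `|q|` small): `S`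
symmetric and coercive with `γ`, `cosh`-weighted row sums `≤ ρ` ⇒ `S_f` coercive with `γ − ρ`.
[cite: Dimock2013, App. D, proof of Lemma 30 (2.), (city2)] [folklore] -/
theorem coercive_conj_of_symm (S : Matrix n n ℝ) (hS : ∀ a b, S b a = S a b) (f : n → ℝ) {γ ρ : ℝ}
    (hρ : 0 ≤ ρ) (hSc : Coercive S γ) (hrow : ∀ a, ∑ b, |S a b| * (Real.cosh (f a - f b) - 1) ≤ ρ) :
    Coercive (QGQInverse.conj f S) (γ - ρ) :=
  coercive_of_form_perturbation hSc (abs_form_conj_sub_le S hS f hρ hrow)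

/-- `S⁻¹ = e^{−f} (S_f)⁻¹ e^{f}` entrywise, whenever `S_f` is invertible. [folklore] -/
theorem inv_apply_eq_conj (S : Matrix n n ℝ) (f : n → ℝ) (hT : IsUnit (QGQInverse.conj f S)) (a b : n) :
    S⁻¹ a b = Real.exp (-f a) * (QGQInverse.conj f S)⁻¹ a b * Real.exp (f b) := by
  set T := QGQInverse.conj f S with hTdef
  have hU : IsUnit T.det := (Matrix.isUnit_iff_isUnit_det T).mp hT
  set M : Matrix n n ℝ := Matrix.of fun a b => Real.exp (-f a) * T⁻¹ a b * Real.exp (f b) with hM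
  have hMS : M * S = 1 := by
    have hTT : T⁻¹ * T = 1 := Matrix.nonsing_inv_mul T hU
    ext a c
    have hSb : ∀ b, S b c = Real.exp (-f b) * Real.exp (f c) * T b c := by
      intro b
      rw [hTdef, conj_apply]
      rw [show Real.exp (-f b) * Real.exp (f c) * (Real.exp (f b - f c) * S b c)
          = (Real.exp (-f b) * Real.exp (f c) * Real.exp (f b - f c)) * S b c by ring]
      rw [← Real.exp_add, ← Real.exp_add]
      simp
    have e1 : (M * S) a c = Real.exp (-f a) * Real.exp (f c) * (T⁻¹ * T) a c := by
      simp only [Matrix.mul_apply, hM, Matrix.of_apply]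
      rw [Finset.mul_sum]
      refine Finset.sum_congr rfl fun b _ => ?_
      rw [hSb b]
      have : Real.exp (f b) * Real.exp (-f b) = 1 := by rw [← Real.exp_add]; simp
      calc Real.exp (-f a) * T⁻¹ a b * Real.exp (f b) * (Real.exp (-f b) * Real.exp (f c) * T b c)
          = Real.exp (-f a) * Real.exp (f c) * (T⁻¹ a b * T b c) * (Real.exp (f b) * Real.exp (-f b)) := by
            ring
        _ = Real.exp (-f a) * Real.exp (f c) * (T⁻¹ a b * T b c) := by rw [this, mul_one]
    rw [e1, hTT]
    by_cases hac : a = c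
    · subst hac
      rw [Matrix.one_apply_eq, ← Real.exp_add]
      simp
    · rw [Matrix.one_apply_ne hac, mul_zero]
  have hinv : S⁻¹ = M := Matrix.inv_eq_left_inv hMS
  rw [hinv, hM, Matrix.of_apply]

/-- The bilinear form of `S⁻¹` through the conjugated inverse:
`⟨v, S⁻¹w⟩ = ⟨e^{−f}v, (S_f)⁻¹ (e^{f}w)⟩` (Dimock: *"⟨f, G_k(Ω)f′⟩ = ⟨e_qf, [e_{−q}G_k(Ω)e_q] e_{−q}f′⟩"*).
[cite: Dimock2013, App. D, (usher1.5)] [folklore] -/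
theorem dot_inv_mulVec_eq_conj (S : Matrix n n ℝ) (f : n → ℝ) (hT : IsUnit (QGQInverse.conj f S)) (v w : n → ℝ) :
    v ⬝ᵥ (S⁻¹ *ᵥ w)
      = (fun a => Real.exp (-f a) * v a) ⬝ᵥ ((QGQInverse.conj f S)⁻¹ *ᵥ fun b => Real.exp (f b) * w b) := by
  simp only [dotProduct, Matrix.mulVec, inv_apply_eq_conj S f hT, Finset.mul_sum]
  exact Finset.sum_congr rfl fun a _ => Finset.sum_congr rfl fun b _ => by ring

/-- `|⟨v, T⁻¹w⟩| ≤ γ⁻¹‖v‖‖w‖` for a coercive `T` (`γ > 0`), Dimock's `‖𝒟_q⁻¹h‖ ≤ 2c₀⁻¹‖h‖` in bilinear form. [folklore] -/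
theorem abs_dot_inv_mulVec_le {T : Matrix n n ℝ} {γ : ℝ} (hγ : 0 < γ) (hT : Coercive T γ) (v w : n → ℝ) :
    |v ⬝ᵥ (T⁻¹ *ᵥ w)| ≤ γ⁻¹ * Real.sqrt (v ⬝ᵥ v) * Real.sqrt (w ⬝ᵥ w) := by
  set y := T⁻¹ *ᵥ w with hy
  have h1 : γ ^ 2 * (y ⬝ᵥ y) ≤ w ⬝ᵥ w := inv_mulVec_sq_le hγ hT w
  have hvv : 0 ≤ v ⬝ᵥ v := Literature.LinearAlgebra.Matrix.dotProduct_self_nonneg_real v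
  have hww : 0 ≤ w ⬝ᵥ w := Literature.LinearAlgebra.Matrix.dotProduct_self_nonneg_real w
  have hcs : (v ⬝ᵥ y) ^ 2 ≤ (v ⬝ᵥ v) * (y ⬝ᵥ y) := B9Thm311.dot_sq_le v y
  have hyy : y ⬝ᵥ y ≤ γ⁻¹ ^ 2 * (w ⬝ᵥ w) := by
    rw [inv_pow, ← div_eq_inv_mul, le_div_iff₀ (pow_pos hγ 2)]
    linarith
  have hsq : (v ⬝ᵥ y) ^ 2 ≤ (γ⁻¹ * Real.sqrt (v ⬝ᵥ v) * Real.sqrt (w ⬝ᵥ w)) ^ 2 := by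
    rw [mul_pow, mul_pow, Real.sq_sqrt hvv, Real.sq_sqrt hww]
    calc (v ⬝ᵥ y) ^ 2 ≤ (v ⬝ᵥ v) * (y ⬝ᵥ y) := hcs
      _ ≤ (v ⬝ᵥ v) * (γ⁻¹ ^ 2 * (w ⬝ᵥ w)) := mul_le_mul_of_nonneg_left hyy hvv
      _ = γ⁻¹ ^ 2 * (v ⬝ᵥ v) * (w ⬝ᵥ w) := by ring
  have h0 : 0 ≤ γ⁻¹ * Real.sqrt (v ⬝ᵥ v) * Real.sqrt (w ⬝ᵥ w) := by positivity
  calc |v ⬝ᵥ y| = Real.sqrt ((v ⬝ᵥ y) ^ 2) := (Real.sqrt_sq_eq_abs _).symm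
    _ ≤ Real.sqrt ((γ⁻¹ * Real.sqrt (v ⬝ᵥ v) * Real.sqrt (w ⬝ᵥ w)) ^ 2) := Real.sqrt_le_sqrt hsq
    _ = γ⁻¹ * Real.sqrt (v ⬝ᵥ v) * Real.sqrt (w ⬝ᵥ w) := Real.sqrt_sq h0

/-- **Dimock's Lemma 30, abstract form (the block-to-block Combes–Thomas bound).**  `S` symmetric and coercive with
`γ`, a weight `f` whose `cosh`-weighted row sums are `≤ ρ < γ`; then for all `v, w`:
`|⟨v, S⁻¹w⟩| ≤ (γ − ρ)⁻¹ ‖e^{−f}v‖ ‖e^{f}w‖` — *"|⟨f, G_k(Ω) f′⟩| … ≤ O(1)‖e_q f‖‖e_{−q} f′‖ ≤ O(1)e^{q·(y−y′)}"*.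
[cite: Dimock2013, App. D, Lemma 30, (usher1.5)] [folklore] -/
theorem abs_dot_inv_le_of_conj (S : Matrix n n ℝ) (hS : ∀ a b, S b a = S a b) (f : n → ℝ) {γ ρ : ℝ}
    (hρ : 0 ≤ ρ) (hργ : ρ < γ) (hSc : Coercive S γ)
    (hrow : ∀ a, ∑ b, |S a b| * (Real.cosh (f a - f b) - 1) ≤ ρ) (v w : n → ℝ) :
    |v ⬝ᵥ (S⁻¹ *ᵥ w)|
      ≤ (γ - ρ)⁻¹ * Real.sqrt ((fun a => Real.exp (-f a) * v a) ⬝ᵥ (fun a => Real.exp (-f a) * v a))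
        * Real.sqrt ((fun b => Real.exp (f b) * w b) ⬝ᵥ (fun b => Real.exp (f b) * w b)) := by
  have hc : Coercive (QGQInverse.conj f S) (γ - ρ) := coercive_conj_of_symm S hS f hρ hSc hrow
  have hpos : 0 < γ - ρ := sub_pos.mpr hργ
  have hU : IsUnit (QGQInverse.conj f S) := isUnit_of_coercive hpos hc
  rw [dot_inv_mulVec_eq_conj S f hU v w]
  exact abs_dot_inv_mulVec_le hpos hc _ _

end FormCT

namespace Torus

/-! ## §2 The sup-circular torus distance on `Tor K = Π_μ ℤ/K_μ` (pulled back from `B4Sect5Torus.tdist`) -/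

section TorusDist

variable {d : ℕ} (K : Fin d → ℕ) [hK : ∀ μ, NeZero (K μ)]

open B4TorusKernel.MultiPeriod B4Sect5Torus

/-- All periods are `≥ 1`. [folklore] -/
theorem one_le_period (μ : Fin d) : 1 ≤ K μ := Nat.one_le_iff_ne_zero.mpr (NeZero.ne (K μ))

/-- The site of `B4Sect5Torus` (coordinates in `Fin (K μ)`) underlying a point of `Tor K` (coordinates in `ZMod (K μ)`). [folklore] -/
def toSite (x : Tor K) : TSite d K := fun μ => ⟨(x μ).val, ZMod.val_lt (x μ)⟩

/-- `toSite` is injective. [folklore] -/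
theorem toSite_injective : Function.Injective (toSite K) := by
  intro x y h
  funext μ
  have := congrArg (fun s : TSite d K => ((s μ : Fin (K μ)) : ℕ)) h
  exact ZMod.val_injective _ this

/-- **The torus distance** on `Π_μ ℤ/K_μ`: `tdistT K x y = max_μ dist(x_μ − y_μ, K_μℤ)` (the sup-circular distance of
`B4Sect5Torus`, transported to `ZMod` coordinates). [folklore] -/
def tdistT (x y : Tor K) : ℝ := tdist K (toSite K x) (toSite K y)

/-- `tdistT` is a pseudo-distance (symmetric, zero diagonal, triangle inequality). [folklore] -/
theorem tdistT_isPseudoDist : IsPseudoDist (tdistT K) :=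
  (⟨fun x y => tdist_symm (one_le_period K) x y, fun x => tdist_self K x,
    fun x y z => tdist_triangle (one_le_period K) x y z⟩ : IsPseudoDist (tdist K)).comp (toSite K)

/-- `tdistT` is symmetric. [folklore] -/
theorem tdistT_symm (x y : Tor K) : tdistT K x y = tdistT K y x := (tdistT_isPseudoDist K).symm x y

/-- `tdistT x x = 0`. [folklore] -/
theorem tdistT_self (x : Tor K) : tdistT K x x = 0 := (tdistT_isPseudoDist K).zero x

/-- Triangle inequality. [folklore] -/
theorem tdistT_triangle (x y z : Tor K) : tdistT K x z ≤ tdistT K x y + tdistT K y z :=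
  (tdistT_isPseudoDist K).triangle x y z

/-- `0 ≤ tdistT`. [folklore] -/
theorem tdistT_nonneg (x y : Tor K) : 0 ≤ tdistT K x y := (tdistT_isPseudoDist K).nonneg x y

/-- Reverse triangle inequality `|d(x,z) − d(y,z)| ≤ d(x,y)`. [folklore] -/
theorem abs_tdistT_sub_le (x y z : Tor K) : |tdistT K x z - tdistT K y z| ≤ tdistT K x y := by
  rw [abs_le]
  constructor
  · have := tdistT_triangle K y x z
    rw [tdistT_symm K y x] at this
    linarith
  · have := tdistT_triangle K x y z
    linarith

/-- **Uniform lattice sums**: `Σ_y e^{−a·tdistT(x,y)} ≤ K_d(a)` (`B4Sect5Proof.latticeConst`), independently of the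
periods. [folklore] -/
theorem tdistT_sumBound : SumBound (tdistT K) (B4Sect5Proof.latticeConst d) := by
  have h : SumBound (tdist K) (B4Sect5Proof.latticeConst d) :=
    fun _ ha x => torusSum_le d (one_le_period K) ha x
  exact SumBound.comp h (toSite_injective K)

/-- Each circular coordinate distance is `≤ tdistT`. [folklore] -/
theorem circAbs_le_tdistT (x y : Tor K) (μ : Fin d) :
    (circAbs (K μ) (((x μ).val : ℤ) - ((y μ).val : ℤ)) : ℝ) ≤ tdistT K x y :=
  circAbs_le_tdist (one_le_period K) (toSite K x) (toSite K y) μ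

/-- `tdistT ≤ t` as soon as every circular coordinate distance is `≤ t` (`t : ℕ`). [folklore] -/
theorem tdistT_le_of_coord (x y : Tor K) (t : ℕ)
    (h : ∀ μ, circAbs (K μ) (((x μ).val : ℤ) - ((y μ).val : ℤ)) ≤ t) : tdistT K x y ≤ t := by
  unfold tdistT tdist
  have hs : Finset.univ.sup (ccoord K (toSite K x) (toSite K y)) ≤ t := by
    refine Finset.sup_le fun μ _ => ?_
    have h1 : ((ccoord K (toSite K x) (toSite K y) μ : ℕ) : ℤ) ≤ t := by
      rw [ccoord_cast (one_le_period K)]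
      exact h μ
    exact_mod_cast h1
  exact_mod_cast hs

/-- There is a coordinate realising the torus distance (for `d ≠ 0`). [folklore] -/
theorem exists_coord_eq_tdistT (hd : d ≠ 0) (x y : Tor K) :
    ∃ μ, tdistT K x y = (circAbs (K μ) (((x μ).val : ℤ) - ((y μ).val : ℤ)) : ℝ) := by
  have hne : (Finset.univ : Finset (Fin d)).Nonempty := by
    rw [Finset.univ_nonempty_iff]
    exact ⟨⟨0, Nat.pos_of_ne_zero hd⟩⟩
  obtain ⟨μ, -, hμ⟩ := Finset.exists_mem_eq_sup Finset.univ hne (ccoord K (toSite K x) (toSite K y))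
  refine ⟨μ, ?_⟩
  unfold tdistT tdist
  rw [hμ]
  have := ccoord_cast (one_le_period K) (toSite K x) (toSite K y) μ
  exact_mod_cast this

/-- `tdistT = 0` when `d = 0`. [folklore] -/
theorem tdistT_eq_zero_of_d (hd : d = 0) (x y : Tor K) : tdistT K x y = 0 := by
  subst hd
  unfold tdistT tdist
  simp

/-- **Nearest neighbours are at torus distance `≤ 1`**: `tdistT(x, x + e_μ) ≤ 1`. [folklore] -/
theorem tdistT_add_unitVec_le (x : Tor K) (μ : Fin d) : tdistT K x (x + unitVec K μ) ≤ 1 := by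
  have h := tdistT_le_of_coord K x (x + unitVec K μ) 1 (fun ν => ?_)
  · exact_mod_cast h
  by_cases hν : ν = μ
  · subst hν
    have hval : ((x + unitVec K ν) ν).val = ((x ν).val + (1 : ZMod (K ν)).val) % K ν := by
      rw [show (x + unitVec K ν) ν = x ν + 1 by simp [unitVec], ZMod.val_add]
    rw [hval, ZMod.val_one_eq_one_mod]
    set n := K ν with hn
    have hn1 : 1 ≤ n := one_le_period K ν
    -- the difference is `−1` modulo `n`
    have hmod : Nat.ModEq n (((x ν).val + 1 % n) % n) ((x ν).val + 1) :=
      (Nat.mod_modEq _ n).trans (Nat.ModEq.add_left _ (Nat.mod_modEq 1 n))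
    obtain ⟨q, hq⟩ := Nat.modEq_iff_dvd.mp hmod
    have hrepr : ((x ν).val : ℤ) - (((((x ν).val + 1 % n) % n : ℕ)) : ℤ) = -1 + n * q := by
      push_cast at hq ⊢
      linarith
    rw [hrepr, circAbs_add_mul]
    calc circAbs n (-1) ≤ |(-1 : ℤ)| := circAbs_le_abs hn1 _
      _ = 1 := by norm_num
  · have hval : (x + unitVec K μ) ν = x ν := by
      simp [unitVec, hν]
    rw [hval, sub_self, circAbs_zero]
    norm_num

/-- `tdistT(x, x − e_μ) ≤ 1`. [folklore] -/
theorem tdistT_sub_unitVec_le (x : Tor K) (μ : Fin d) : tdistT K x (x - unitVec K μ) ≤ 1 := by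
  have h := tdistT_add_unitVec_le K (x - unitVec K μ) μ
  rw [sub_add_cancel, tdistT_symm] at h
  exact h

end TorusDist

/-! ## §2b Blocks versus the torus distance: same-block sites are close, distinct blocks are far -/

section BlockGeometry

variable {d : ℕ} (N : ℕ) [NeZero N] (M : Fin d → ℕ) [hM : ∀ μ, NeZero (M μ)]

open B4TorusKernel.MultiPeriod B4Sect5Torus

/-- Every fine site is `site b j` with `b` its block. [folklore] -/
theorem exists_eq_site (x : Tor (fine N M)) : ∃ j : Fin d → Fin N, x = site N M (blockOf N M x) j := by
  refine ⟨((blockEquiv N M).symm x).2, ?_⟩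
  have h := (blockEquiv N M).apply_symm_apply x
  conv_lhs => rw [← h]
  rfl

omit [NeZero N] in
/-- The integer coordinate difference of two sites: `N(b_μ − b′_μ) + (j_μ − j′_μ)`. [folklore] -/
theorem val_site_sub (b b' : Tor M) (j j' : Fin d → Fin N) (μ : Fin d) :
    ((site N M b j μ).val : ℤ) - ((site N M b' j' μ).val : ℤ)
      = (N : ℤ) * (((b μ).val : ℤ) - ((b' μ).val : ℤ)) + (((j μ : ℕ) : ℤ) - ((j' μ : ℕ) : ℤ)) := by
  rw [val_site, val_site]
  push_cast
  ring

omit [NeZero N] in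
/-- In-block offsets differ by at most `N − 1`. [folklore] -/
theorem abs_offset_sub_le (j j' : Fin d → Fin N) (μ : Fin d) :
    |(((j μ : ℕ) : ℤ) - ((j' μ : ℕ) : ℤ))| ≤ (N : ℤ) - 1 := by
  have h1 : ((j μ : ℕ) : ℤ) < N := by exact_mod_cast (j μ).isLt
  have h2 : ((j' μ : ℕ) : ℤ) < N := by exact_mod_cast (j' μ).isLt
  have h3 : (0 : ℤ) ≤ ((j μ : ℕ) : ℤ) := by positivity
  have h4 : (0 : ℤ) ≤ ((j' μ : ℕ) : ℤ) := by positivity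
  rw [abs_le]
  constructor <;> linarith

/-- **Sites of one block are within torus distance `N − 1`.** [folklore] -/
theorem tdistT_site_site_le (b : Tor M) (j j' : Fin d → Fin N) :
    tdistT (fine N M) (site N M b j) (site N M b j') ≤ (N : ℝ) - 1 := by
  have hN1 : 1 ≤ N := Nat.one_le_iff_ne_zero.mpr (NeZero.ne N)
  have h := tdistT_le_of_coord (fine N M) (site N M b j) (site N M b j') (N - 1) (fun μ => ?_)
  · have e : (((N - 1 : ℕ)) : ℝ) = (N : ℝ) - 1 := by rw [Nat.cast_sub hN1, Nat.cast_one]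
    rw [e] at h
    exact h
  rw [val_site_sub, sub_self, mul_zero, zero_add]
  have hNM : 1 ≤ fine N M μ := one_le_period (fine N M) μ
  calc circAbs (fine N M μ) (((j μ : ℕ) : ℤ) - ((j' μ : ℕ) : ℤ))
      ≤ |(((j μ : ℕ) : ℤ) - ((j' μ : ℕ) : ℤ))| := circAbs_le_abs hNM _
    _ ≤ (N : ℤ) - 1 := abs_offset_sub_le N j j' μ
    _ = ((N - 1 : ℕ) : ℤ) := by rw [Nat.cast_sub hN1, Nat.cast_one]

/-- **Two sites of the same block are within torus distance `N − 1`** (form with `blockOf`). [folklore] -/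
theorem tdistT_le_of_blockOf_eq {x x' : Tor (fine N M)} (h : blockOf N M x = blockOf N M x') :
    tdistT (fine N M) x x' ≤ (N : ℝ) - 1 := by
  obtain ⟨j, hj⟩ := exists_eq_site N M x
  obtain ⟨j', hj'⟩ := exists_eq_site N M x'
  rw [hj, hj', h]
  exact tdistT_site_site_le N M _ _ _

omit [NeZero N] in
/-- One coordinate: `N·dist(β, Mℤ) ≤ dist(Nβ + δ, NMℤ) + |δ|`. [folklore] -/
theorem mul_circAbs_le (Mμ : ℕ) (hMμ : 1 ≤ Mμ) (hN1 : 1 ≤ N) (β δ : ℤ) :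
    (N : ℤ) * circAbs Mμ β ≤ circAbs (N * Mμ) ((N : ℤ) * β + δ) + |δ| := by
  have hNM : 1 ≤ N * Mμ := Nat.one_le_iff_ne_zero.mpr (Nat.mul_ne_zero (by omega) (by omega))
  set zz : ℤ := (N : ℤ) * β + δ with hzz
  set c : ℤ := centre (N * Mμ) zz with hc
  have h1 : |zz + ((N * Mμ : ℕ) : ℤ) * c| = circAbs (N * Mμ) zz := abs_add_mul_centre hNM zz
  have h2 : zz + ((N * Mμ : ℕ) : ℤ) * c = (N : ℤ) * (β + (Mμ : ℤ) * c) + δ := by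
    rw [hzz]; push_cast; ring
  have h3 : (N : ℤ) * circAbs Mμ β ≤ |(N : ℤ) * (β + (Mμ : ℤ) * c)| := by
    rw [abs_mul, abs_of_nonneg (by positivity : (0 : ℤ) ≤ N)]
    refine mul_le_mul_of_nonneg_left ?_ (by positivity)
    rw [← circAbs_add_mul Mμ β c]
    exact circAbs_le_abs hMμ _
  have h4 : |(N : ℤ) * (β + (Mμ : ℤ) * c)| ≤ |zz + ((N * Mμ : ℕ) : ℤ) * c| + |δ| := by
    have : (N : ℤ) * (β + (Mμ : ℤ) * c) = (zz + ((N * Mμ : ℕ) : ℤ) * c) - δ := by rw [h2]; ring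
    rw [this]
    exact abs_sub _ _
  linarith

/-- **Distinct blocks are far on the fine lattice**: for sites `x ∈ B(b)`, `x′ ∈ B(b′)`,
`N · tdistT(b, b′) ≤ tdistT(x, x′) + (N − 1)` (unit-lattice distance of the blocks versus fine-lattice distance of
their sites). [folklore] -/
theorem mul_tdistT_blocks_le (b b' : Tor M) (j j' : Fin d → Fin N) :
    (N : ℝ) * tdistT M b b' ≤ tdistT (fine N M) (site N M b j) (site N M b' j') + ((N : ℝ) - 1) := by
  have hN1 : 1 ≤ N := Nat.one_le_iff_ne_zero.mpr (NeZero.ne N)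
  rcases Nat.eq_zero_or_pos d with hd | hd
  · rw [tdistT_eq_zero_of_d M hd, tdistT_eq_zero_of_d (fine N M) hd, mul_zero, zero_add, sub_nonneg]
    exact_mod_cast hN1
  obtain ⟨μ, hμ⟩ := exists_coord_eq_tdistT M (by omega) b b'
  rw [hμ]
  have hβ := mul_circAbs_le N (M μ) (one_le_period M μ) hN1 (((b μ).val : ℤ) - ((b' μ).val : ℤ))
    (((j μ : ℕ) : ℤ) - ((j' μ : ℕ) : ℤ))
  rw [← val_site_sub N M b b' j j' μ] at hβ
  have hfine := circAbs_le_tdistT (fine N M) (site N M b j) (site N M b' j') μ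
  have hoff := abs_offset_sub_le N j j' μ
  have hβR : (N : ℝ) * (circAbs (M μ) (((b μ).val : ℤ) - ((b' μ).val : ℤ)) : ℝ)
      ≤ (circAbs (fine N M μ) (((site N M b j μ).val : ℤ) - ((site N M b' j' μ).val : ℤ)) : ℝ)
        + (|(((j μ : ℕ) : ℤ) - ((j' μ : ℕ) : ℤ))| : ℤ) := by
    exact_mod_cast hβ
  have hoffR : ((|(((j μ : ℕ) : ℤ) - ((j' μ : ℕ) : ℤ))| : ℤ) : ℝ) ≤ (N : ℝ) - 1 := by exact_mod_cast hoff
  linarith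

end BlockGeometry

/-! ## §3 Dimock's Lemma 29 on the torus: the averaging term supplies an effective mass, UNIFORMLY in `N = L^k` -/

section FineOperator

variable {d : ℕ} (N : ℕ) [NeZero N] (M : Fin d → ℕ) [hM : ∀ μ, NeZero (M μ)]

open QGQInverse

/-- **The `N`-uniform coercivity constant of `A₀ = N²(−Δ) + m² + a·Q*Q`**: `γ_A = min(4c₀/(c₀+4), a·c₀/4)`,
`c₀ = (4/π²)^d` (the fibre constant of `EndpointCoercivity.fibre_coercive` with off-centre symbol bound `δ = 4`).
[cite: Dimock2013, App. D, Lemma 29 ("for a constant c₀ = O(1)")] [folklore] -/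
def gamA (a : ℝ) (dd : ℕ) : ℝ := min (4 * (4 / π ^ 2) ^ dd / ((4 / π ^ 2) ^ dd + 4)) (a * (4 / π ^ 2) ^ dd / 4)

/-- `γ_A > 0` for `a > 0`. [folklore] -/
theorem gamA_pos {a : ℝ} (ha : 0 < a) (dd : ℕ) : 0 < gamA a dd := by
  unfold gamA
  exact lt_min (by positivity) (by positivity)

/-- `γ_A` does not depend on `N`, `M`, `m²` — recorded as the trivial monotonicity `γ_A ≤ a c₀/4 ≤ a/4`. [folklore] -/
theorem gamA_le {a : ℝ} (ha : 0 ≤ a) (dd : ℕ) : gamA a dd ≤ a / 4 := by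
  unfold gamA
  refine (min_le_right _ _).trans ?_
  have h1 : (4 / π ^ 2 : ℝ) ^ dd ≤ 1 := by
    apply pow_le_one₀ (by positivity)
    rw [div_le_one (by positivity)]
    nlinarith [Real.pi_gt_three]
  have := mul_le_mul_of_nonneg_left h1 ha
  linarith

/-- **Off-centre aliases carry symbol `≥ 4`**: for `p` in the fibre of `q` other than the central alias, the
symbol of `N²(−Δ) + m²` is `≥ N²·(4/π²)(π/N)² = 4` (`off_centre` + Jordan).  This is Dimock's "since the lowest
non-zero eigenvalue of −Δ is O(1) … ⟨f, [−Δ]f⟩ ≥ O(1)‖f‖² for f ⊥ constants" in Fourier form.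
[cite: Dimock2013, App. D, proof of Lemma 29] [folklore] -/
theorem lapSym_ge_four_of_off_centre (hN1 : 1 ≤ N) {m2 : ℝ} (hm : 0 ≤ m2) {q : Tor M}
    {p : Tor (fine N M)} (hp : p ∈ fib N M q) (hne : p ≠ z N M q) :
    4 ≤ lapSym (fine N M) ((N : ℝ) ^ 2) m2 p := by
  obtain ⟨μ, hμ⟩ := off_centre N M hp hne
  have hNpos : (0 : ℝ) < N := by exact_mod_cast (show 0 < N by omega)
  have hπN : 0 < π / N := by positivity
  have hs : (π / N) ^ 2 ≤ (sOf (fine N M) p μ) ^ 2 := by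
    rw [← sq_abs (sOf (fine N M) p μ)]
    exact pow_le_pow_left₀ hπN.le hμ 2
  have hS1 : 4 * (sOf (fine N M) p μ) ^ 2 / π ^ 2 ≤ 2 - 2 * Real.cos (sOf (fine N M) p μ) :=
    B4Strip.S1r_ge _ (abs_sOf_le (fine N M) p μ)
  have hterm : ∀ ν, 0 ≤ 2 - 2 * Real.cos (sOf (fine N M) p ν) := fun ν => by
    linarith [Real.cos_le_one (sOf (fine N M) p ν)]
  have hsum : 2 - 2 * Real.cos (sOf (fine N M) p μ) ≤ ∑ ν, (2 - 2 * Real.cos (sOf (fine N M) p ν)) :=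
    Finset.single_le_sum (f := fun ν => 2 - 2 * Real.cos (sOf (fine N M) p ν)) (fun ν _ => hterm ν)
      (Finset.mem_univ μ)
  unfold lapSym
  have h4 : (4 : ℝ) = (N : ℝ) ^ 2 * (4 * (π / N) ^ 2 / π ^ 2) := by
    field_simp
  calc (4 : ℝ) = (N : ℝ) ^ 2 * (4 * (π / N) ^ 2 / π ^ 2) := h4
    _ ≤ (N : ℝ) ^ 2 * (4 * (sOf (fine N M) p μ) ^ 2 / π ^ 2) := by gcongr
    _ ≤ (N : ℝ) ^ 2 * (2 - 2 * Real.cos (sOf (fine N M) p μ)) := by gcongr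
    _ ≤ (N : ℝ) ^ 2 * ∑ ν, (2 - 2 * Real.cos (sOf (fine N M) p ν)) := by gcongr
    _ ≤ m2 + (N : ℝ) ^ 2 * ∑ ν, (2 - 2 * Real.cos (sOf (fine N M) p ν)) := by linarith

/-- **DIMOCK'S LEMMA 29 ON THE TORUS, King's normalisation**: for every `N ≥ 1`, `a ≥ 0`, `m² ≥ 0` and every torus
`Π ℤ/M_μ`, the fine operator `A₀ = N²(−Δ) + m² + a·Q*Q` on `Π ℤ/(NM_μ)` satisfies `⟨ψ, A₀ψ⟩ ≥ γ_A‖ψ‖²` with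
`γ_A = gamA a d` INDEPENDENT of `N`, `M`, `m²` — "the averaging operator `a_kQ_k^TQ_k` supplies an effective mass".
Proof = the fibre (Bloch) decomposition of `TorusBlockForm` (`form_decomp`, Parseval `pars_decomp`) and the two-case
fibre estimate `EndpointCoercivity.fibre_coercive` with the off-centre bound `≥ 4` above, central alias weight
`≥ (4/π²)^d` (`norm_sq_u_central`) and fibre Parseval `Σ|u|² = 1` (`sum_fib_norm_sq_u`); Dimock proves it on unit
cubes with Neumann conditions by "constants vs. orthogonal-to-constants" and drops bonds between cubes.
[cite: Dimock2013, App. D, Lemma 29 (\label{twentynine}), arXiv:1108.1335v2] -/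
theorem fineOp_coercive_unif (hN1 : 1 ≤ N) {a m2 : ℝ} (ha : 0 ≤ a) (hm : 0 ≤ m2) :
    Coercive (fineOp N M a ((N : ℝ) ^ 2) m2) (gamA a d) := by
  set σ : (Fin d → ℝ) → ℝ := fun s => m2 + (N : ℝ) ^ 2 * ∑ μ, (2 - 2 * Real.cos (s μ)) with hσ
  have hsymb : ∀ p, symb (fine N M) (lapF (fine N M) ((N : ℝ) ^ 2) m2) p = σ (sOf (fine N M) p) := by
    intro p
    rw [symb_lapF]
    rfl
  have hform := form_decomp N M (lapF (fine N M) ((N : ℝ) ^ 2) m2) (lapF_transl (fine N M) _ _) σ hsymb a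
  refine coercive_of_fibre_form (fineOp N M a ((N : ℝ) ^ 2) m2)
    (fun q x => ∑ p ∈ fib N M q, σ (sOf (fine N M) p) * ‖coef N M x p‖ ^ 2
      + a * ‖∑ p ∈ fib N M q, u N M p * coef N M x p‖ ^ 2)
    (fun q x => ∑ p ∈ fib N M q, ‖coef N M x p‖ ^ 2) (fun x => hform x) (fun q x => ?_) (pars_decomp N M)
  have h := fibre_coercive (fib N M q) (z_mem_fib N M q) (fun p => σ (sOf (fine N M) p)) (u N M)
    (fun p => coef N M x p) (α := a) (δ := 4) (c₀ := (4 / π ^ 2) ^ d) ha (by norm_num) (by positivity)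
    (fun p _ => by
      show 0 ≤ m2 + (N : ℝ) ^ 2 * ∑ μ, (2 - 2 * Real.cos (sOf (fine N M) p μ))
      have : 0 ≤ ∑ μ, (2 - 2 * Real.cos (sOf (fine N M) p μ)) :=
        Finset.sum_nonneg fun μ _ => by linarith [Real.cos_le_one (sOf (fine N M) p μ)]
      positivity)
    (fun p hp hne => lapSym_ge_four_of_off_centre N M hN1 hm hp hne)
    (norm_sq_u_central N M hN1 q) (sum_fib_norm_sq_u N M q).le
  unfold gamA
  exact h

end FineOperator

/-! ## §3b The conjugation defects of `A₀ = N²(−Δ) + m² + a·Q*Q` are second order, uniformly in `N`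
(Dimock's (city1): `|⟨f,[𝒟_q − 𝒟_0]f⟩| ≤ c₁|q|⟨f,(−Δ+I)f⟩`; here with the `cosh` weights of §1) -/

section Defects

variable {d : ℕ}

/-- **Laplacian part.**  If the weight oscillates by at most `θ` across every bond, the `cosh`-weighted row sums
of `c(−Δ) + m²` are `≤ c·2d·(cosh θ − 1)` (the diagonal carries weight `cosh 0 − 1 = 0`). [folklore] -/
theorem lapF_coshRow_le (K : Fin d → ℕ) [∀ μ, NeZero (K μ)] {c m2 : ℝ} (hc : 0 ≤ c) (hm : 0 ≤ m2)
    (f : Tor K → ℝ) {θ : ℝ}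
    (hf : ∀ x μ, |f x - f (x + unitVec K μ)| ≤ θ ∧ |f x - f (x - unitVec K μ)| ≤ θ) (x : Tor K) :
    ∑ x', |lapF K c m2 x x'| * (Real.cosh (f x - f x') - 1) ≤ c * (2 * d) * (Real.cosh θ - 1) := by
  have hw0 : ∀ x', 0 ≤ Real.cosh (f x - f x') - 1 := fun x' => by
    linarith [Real.one_le_cosh (f x - f x')]
  have hwθ : ∀ x', |f x - f x'| ≤ θ → Real.cosh (f x - f x') - 1 ≤ Real.cosh θ - 1 := by
    intro x' h
    have : Real.cosh (f x - f x') ≤ Real.cosh θ := by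
      rw [Real.cosh_le_cosh]
      exact h.trans (le_abs_self θ)
    linarith
  -- entry bound by a nonnegative combination of indicator functions
  set A : Tor K → ℝ := fun x' => (m2 + 2 * d * c) * (if x' = x then 1 else 0) with hA
  set B : Tor K → ℝ := fun x' =>
    c * ∑ μ : Fin d, ((if x' = x + unitVec K μ then (1 : ℝ) else 0) + (if x' = x - unitVec K μ then 1 else 0))
    with hB
  have hent : ∀ x', |lapF K c m2 x x'| ≤ A x' + B x' := by
    intro x'
    have hA0 : 0 ≤ A x' := by
      simp only [hA]
      have : 0 ≤ m2 + 2 * d * c := by positivity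
      split_ifs <;> nlinarith
    have hB0 : 0 ≤ B x' := by
      simp only [hB]
      refine mul_nonneg hc (Finset.sum_nonneg fun μ _ => ?_)
      split_ifs <;> norm_num
    have e : lapF K c m2 x x' = A x' - B x' := by simp only [lapF, hA, hB]
    rw [e]
    calc |A x' - B x'| ≤ |A x'| + |B x'| := abs_sub _ _
      _ = A x' + B x' := by rw [abs_of_nonneg hA0, abs_of_nonneg hB0]
  -- the diagonal indicator carries weight 0
  have hAsum : ∑ x', A x' * (Real.cosh (f x - f x') - 1) = 0 := by
    simp only [hA]
    rw [Finset.sum_eq_single x]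
    · simp
    · intro x' _ hx'
      rw [if_neg hx']
      ring
    · intro h; exact absurd (Finset.mem_univ _) h
  -- the bond indicators carry weight ≤ cosh θ − 1 each
  have hBsum : ∑ x', B x' * (Real.cosh (f x - f x') - 1) ≤ c * (2 * d) * (Real.cosh θ - 1) := by
    have hind : ∀ (y : Tor K), |f x - f y| ≤ θ →
        ∑ x', (if x' = y then (1 : ℝ) else 0) * (Real.cosh (f x - f x') - 1) ≤ Real.cosh θ - 1 := by
      intro y hy
      rw [Finset.sum_eq_single y]
      · rw [if_pos rfl, one_mul]; exact hwθ y hy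
      · intro x' _ hx'; rw [if_neg hx']; ring
      · intro h; exact absurd (Finset.mem_univ _) h
    have e : ∑ x', B x' * (Real.cosh (f x - f x') - 1)
        = c * ∑ μ : Fin d, (∑ x', (if x' = x + unitVec K μ then (1 : ℝ) else 0) * (Real.cosh (f x - f x') - 1)
          + ∑ x', (if x' = x - unitVec K μ then (1 : ℝ) else 0) * (Real.cosh (f x - f x') - 1)) := by
      calc ∑ x', B x' * (Real.cosh (f x - f x') - 1)
          = ∑ x', ∑ μ : Fin d, c * (((if x' = x + unitVec K μ then (1 : ℝ) else 0)
              + (if x' = x - unitVec K μ then 1 else 0)) * (Real.cosh (f x - f x') - 1)) := by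
            refine Finset.sum_congr rfl fun x' _ => ?_
            simp only [hB]
            rw [Finset.mul_sum, Finset.sum_mul]
            exact Finset.sum_congr rfl fun μ _ => by ring
        _ = ∑ μ : Fin d, ∑ x', c * (((if x' = x + unitVec K μ then (1 : ℝ) else 0)
              + (if x' = x - unitVec K μ then 1 else 0)) * (Real.cosh (f x - f x') - 1)) := Finset.sum_comm
        _ = c * ∑ μ : Fin d, (∑ x', (if x' = x + unitVec K μ then (1 : ℝ) else 0) * (Real.cosh (f x - f x') - 1)
              + ∑ x', (if x' = x - unitVec K μ then (1 : ℝ) else 0) * (Real.cosh (f x - f x') - 1)) := by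
            rw [Finset.mul_sum]
            refine Finset.sum_congr rfl fun μ _ => ?_
            rw [← Finset.sum_add_distrib, Finset.mul_sum]
            exact Finset.sum_congr rfl fun x' _ => by ring
    rw [e]
    have hμ : ∀ μ : Fin d,
        (∑ x', (if x' = x + unitVec K μ then (1 : ℝ) else 0) * (Real.cosh (f x - f x') - 1)
          + ∑ x', (if x' = x - unitVec K μ then (1 : ℝ) else 0) * (Real.cosh (f x - f x') - 1))
        ≤ 2 * (Real.cosh θ - 1) := fun μ => by
      have h1 := hind (x + unitVec K μ) (hf x μ).1
      have h2 := hind (x - unitVec K μ) (hf x μ).2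
      linarith
    calc c * ∑ μ : Fin d, (∑ x', (if x' = x + unitVec K μ then (1 : ℝ) else 0) * (Real.cosh (f x - f x') - 1)
          + ∑ x', (if x' = x - unitVec K μ then (1 : ℝ) else 0) * (Real.cosh (f x - f x') - 1))
        ≤ c * ∑ _μ : Fin d, 2 * (Real.cosh θ - 1) :=
          mul_le_mul_of_nonneg_left (Finset.sum_le_sum fun μ _ => hμ μ) hc
      _ = c * (2 * d) * (Real.cosh θ - 1) := by
          rw [Finset.sum_const, Finset.card_univ, Fintype.card_fin, nsmul_eq_mul]; ring
  calc ∑ x', |lapF K c m2 x x'| * (Real.cosh (f x - f x') - 1)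
      ≤ ∑ x', (A x' + B x') * (Real.cosh (f x - f x') - 1) :=
        Finset.sum_le_sum fun x' _ => mul_le_mul_of_nonneg_right (hent x') (hw0 x')
    _ = ∑ x', A x' * (Real.cosh (f x - f x') - 1) + ∑ x', B x' * (Real.cosh (f x - f x') - 1) := by
        rw [← Finset.sum_add_distrib]
        exact Finset.sum_congr rfl fun x' _ => by ring
    _ ≤ c * (2 * d) * (Real.cosh θ - 1) := by rw [hAsum, zero_add]; exact hBsum

variable (N : ℕ) [NeZero N] (M : Fin d → ℕ) [hM : ∀ μ, NeZero (M μ)]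

/-- `Q*Q ≥ 0` entrywise. [folklore] -/
theorem blockProj_entry_nonneg (x x' : Tor (fine N M)) : 0 ≤ blockProj N M x x' := by
  unfold blockProj
  split_ifs <;> positivity

/-- The row sums of the block-mean projector are `1`. [folklore] -/
theorem sum_blockProj_row (x : Tor (fine N M)) : ∑ x', blockProj N M x x' = 1 := by
  have hNd : ((N : ℝ) ^ d) ≠ 0 := pow_ne_zero _ (by exact_mod_cast NeZero.ne N)
  unfold blockProj
  rw [← (blockEquiv N M).sum_comp, Fintype.sum_prod_type]
  simp only [blockEquiv_apply, blockOf_site]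
  rw [Finset.sum_comm, Finset.sum_congr rfl fun j _ => Finset.sum_ite_eq Finset.univ (blockOf N M x)
    (fun _ => ((N : ℝ) ^ d)⁻¹)]
  simp only [Finset.mem_univ, if_true, Finset.sum_const, Finset.card_univ, Fintype.card_fun, Fintype.card_fin,
    nsmul_eq_mul]
  push_cast
  exact mul_inv_cancel₀ hNd

/-- **Block part.**  If the weight oscillates by at most `Θ` on each `N`-block, the `cosh`-weighted row sums of
`Q*Q` are `≤ cosh Θ − 1`. [folklore] -/
theorem blockProj_coshRow_le (f : Tor (fine N M) → ℝ) {Θ : ℝ}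
    (hf : ∀ x x', blockOf N M x = blockOf N M x' → |f x - f x'| ≤ Θ) (x : Tor (fine N M)) :
    ∑ x', |blockProj N M x x'| * (Real.cosh (f x - f x') - 1) ≤ Real.cosh Θ - 1 := by
  have hΘ : 0 ≤ Real.cosh Θ - 1 := by linarith [Real.one_le_cosh Θ]
  have hterm : ∀ x', |blockProj N M x x'| * (Real.cosh (f x - f x') - 1)
      ≤ blockProj N M x x' * (Real.cosh Θ - 1) := by
    intro x'
    rw [abs_of_nonneg (blockProj_entry_nonneg N M x x')]
    by_cases h : blockOf N M x = blockOf N M x'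
    · refine mul_le_mul_of_nonneg_left ?_ (blockProj_entry_nonneg N M x x')
      have : Real.cosh (f x - f x') ≤ Real.cosh Θ := by
        rw [Real.cosh_le_cosh]
        exact (hf x x' h).trans (le_abs_self Θ)
      linarith
    · have : blockProj N M x x' = 0 := by unfold blockProj; rw [if_neg h]
      rw [this, zero_mul, zero_mul]
  calc ∑ x', |blockProj N M x x'| * (Real.cosh (f x - f x') - 1)
      ≤ ∑ x', blockProj N M x x' * (Real.cosh Θ - 1) := Finset.sum_le_sum fun x' _ => hterm x'
    _ = Real.cosh Θ - 1 := by rw [← Finset.sum_mul, sum_blockProj_row, one_mul]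

/-- **The Combes–Thomas weight of Lemma 30**: `f(x) = (κ/N)·tdist(x, x₀)` on the fine torus — `κ ×` a function
`1`-Lipschitz in the UNIT-lattice (physical) distance `tdist/N`; Dimock's `e_q(x) = e^{q·x}`, `|q| ≤ δ₀`.
[cite: Dimock2013, App. D, proof of Lemma 30 ("Take q = δ₀[−(y−y′)/|y−y′|]")] [folklore] -/
def ctW (κ : ℝ) (x₀ x : Tor (fine N M)) : ℝ := κ / N * tdistT (fine N M) x x₀

/-- The weight is `(κ/N)`-Lipschitz for the fine torus distance. [folklore] -/
theorem abs_ctW_sub_le {κ : ℝ} (hκ : 0 ≤ κ) (x₀ x x' : Tor (fine N M)) :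
    |ctW N M κ x₀ x - ctW N M κ x₀ x'| ≤ κ / N * tdistT (fine N M) x x' := by
  unfold ctW
  rw [← mul_sub, abs_mul, abs_of_nonneg (by positivity)]
  exact mul_le_mul_of_nonneg_left (abs_tdistT_sub_le (fine N M) x x' x₀) (by positivity)

/-- Across a bond the weight oscillates by `≤ κ/N`. [folklore] -/
theorem abs_ctW_bond_le {κ : ℝ} (hκ : 0 ≤ κ) (x₀ x : Tor (fine N M)) (μ : Fin d) :
    |ctW N M κ x₀ x - ctW N M κ x₀ (x + unitVec (fine N M) μ)| ≤ κ / N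
      ∧ |ctW N M κ x₀ x - ctW N M κ x₀ (x - unitVec (fine N M) μ)| ≤ κ / N := by
  have hκN : 0 ≤ κ / N := by positivity
  constructor
  · refine (abs_ctW_sub_le N M hκ x₀ x _).trans ?_
    calc κ / N * tdistT (fine N M) x (x + unitVec (fine N M) μ) ≤ κ / N * 1 :=
          mul_le_mul_of_nonneg_left (tdistT_add_unitVec_le (fine N M) x μ) hκN
      _ = κ / N := mul_one _
  · refine (abs_ctW_sub_le N M hκ x₀ x _).trans ?_
    calc κ / N * tdistT (fine N M) x (x - unitVec (fine N M) μ) ≤ κ / N * 1 :=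
          mul_le_mul_of_nonneg_left (tdistT_sub_unitVec_le (fine N M) x μ) hκN
      _ = κ / N := mul_one _

/-- On one block the weight oscillates by `≤ κ(N−1)/N ≤ κ`. [folklore] -/
theorem abs_ctW_block_le {κ : ℝ} (hκ : 0 ≤ κ) (x₀ x x' : Tor (fine N M))
    (h : blockOf N M x = blockOf N M x') : |ctW N M κ x₀ x - ctW N M κ x₀ x'| ≤ κ := by
  have hN : (0 : ℝ) < N := by exact_mod_cast Nat.pos_of_ne_zero (NeZero.ne N)
  refine (abs_ctW_sub_le N M hκ x₀ x x').trans ?_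
  calc κ / N * tdistT (fine N M) x x' ≤ κ / N * ((N : ℝ) - 1) :=
        mul_le_mul_of_nonneg_left (tdistT_le_of_blockOf_eq N M h) (by positivity)
    _ = κ - κ / N := by field_simp
    _ ≤ κ := by linarith [div_nonneg hκ hN.le]

/-- **The defect of `A₀` is second order in `κ`, uniformly in `N`**: with the weight `ctW`, `0 ≤ κ ≤ 1`,
`Σ_{x′} |A₀(x,x′)| (cosh(f x − f x′) − 1) ≤ (2d + a)κ²` — the bond coefficients `N²` are compensated by the
oscillation `κ/N` (`N²(cosh(κ/N) − 1) ≤ κ²`, tree `Beta.CombesThomasForm.inv_sq_mul_cosh_sub_one_le`), the block term by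
`cosh κ − 1 ≤ κ²`.  This is the kernel form of Dimock's (city1) `|⟨f,[𝒟_q − 𝒟_0]f⟩| ≤ c₁|q|⟨f,(−Δ+I)f⟩`, second
order because of the `cosh` symmetrisation of §1.  [cite: Dimock2013, App. D, proof of Lemma 30 (1.)] [folklore] -/
theorem fineOp_coshRow_le {a m2 κ : ℝ} (ha : 0 ≤ a) (hm : 0 ≤ m2) (hκ0 : 0 ≤ κ) (hκ1 : κ ≤ 1)
    (x₀ x : Tor (fine N M)) :
    ∑ x', |fineOp N M a ((N : ℝ) ^ 2) m2 x x'| * (Real.cosh (ctW N M κ x₀ x - ctW N M κ x₀ x') - 1)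
      ≤ (2 * d + a) * κ ^ 2 := by
  have hN : (0 : ℝ) < N := by exact_mod_cast Nat.pos_of_ne_zero (NeZero.ne N)
  have hN1 : (1 : ℝ) ≤ N := by exact_mod_cast Nat.one_le_iff_ne_zero.mpr (NeZero.ne N)
  have hw0 : ∀ x', 0 ≤ Real.cosh (ctW N M κ x₀ x - ctW N M κ x₀ x') - 1 := fun x' => by
    linarith [Real.one_le_cosh (ctW N M κ x₀ x - ctW N M κ x₀ x')]
  -- Laplacian part
  have hL := lapF_coshRow_le (fine N M) (c := (N : ℝ) ^ 2) (by positivity) hm (ctW N M κ x₀)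
    (θ := κ / N) (fun y μ => abs_ctW_bond_le N M hκ0 x₀ y μ) x
  have hcosh1 : (N : ℝ) ^ 2 * (Real.cosh (κ / N) - 1) ≤ κ ^ 2 := by
    have h := Beta.CombesThomasForm.inv_sq_mul_cosh_sub_one_le (η := (N : ℝ)⁻¹) (δ := κ) (t := κ / N)
      (inv_pos.mpr hN) (by rw [abs_of_nonneg (by positivity), div_eq_mul_inv])
      (by rw [← div_eq_mul_inv, div_le_one hN]; exact hκ1.trans hN1)
    rwa [inv_pow, inv_inv] at h
  -- block part
  have hB := blockProj_coshRow_le N M (ctW N M κ x₀) (Θ := κ)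
    (fun y y' h => abs_ctW_block_le N M hκ0 x₀ y y' h) x
  have hcosh2 : Real.cosh κ - 1 ≤ κ ^ 2 :=
    Literature.MathematicalPhysics.QuantumLattice.cosh_sub_one_le_sq_of_abs_le_one
      (by rw [abs_of_nonneg hκ0]; exact hκ1)
  -- entries of A₀ split
  have hent : ∀ x', |fineOp N M a ((N : ℝ) ^ 2) m2 x x'|
      ≤ |lapF (fine N M) ((N : ℝ) ^ 2) m2 x x'| + a * |blockProj N M x x'| := by
    intro x'
    rw [fineOp, Matrix.add_apply, Matrix.smul_apply, smul_eq_mul]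
    calc |lapF (fine N M) ((N : ℝ) ^ 2) m2 x x' + a * blockProj N M x x'|
        ≤ |lapF (fine N M) ((N : ℝ) ^ 2) m2 x x'| + |a * blockProj N M x x'| := abs_add_le _ _
      _ = _ := by rw [abs_mul, abs_of_nonneg ha]
  calc ∑ x', |fineOp N M a ((N : ℝ) ^ 2) m2 x x'| * (Real.cosh (ctW N M κ x₀ x - ctW N M κ x₀ x') - 1)
      ≤ ∑ x', (|lapF (fine N M) ((N : ℝ) ^ 2) m2 x x'| + a * |blockProj N M x x'|)
          * (Real.cosh (ctW N M κ x₀ x - ctW N M κ x₀ x') - 1) :=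
        Finset.sum_le_sum fun x' _ => mul_le_mul_of_nonneg_right (hent x') (hw0 x')
    _ = ∑ x', |lapF (fine N M) ((N : ℝ) ^ 2) m2 x x'| * (Real.cosh (ctW N M κ x₀ x - ctW N M κ x₀ x') - 1)
        + a * ∑ x', |blockProj N M x x'| * (Real.cosh (ctW N M κ x₀ x - ctW N M κ x₀ x') - 1) := by
        rw [Finset.mul_sum, ← Finset.sum_add_distrib]
        exact Finset.sum_congr rfl fun x' _ => by ring
    _ ≤ (N : ℝ) ^ 2 * (2 * d) * (Real.cosh (κ / N) - 1) + a * (Real.cosh κ - 1) :=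
        add_le_add hL (mul_le_mul_of_nonneg_left hB ha)
    _ = (2 * d) * ((N : ℝ) ^ 2 * (Real.cosh (κ / N) - 1)) + a * (Real.cosh κ - 1) := by ring
    _ ≤ (2 * d) * κ ^ 2 + a * κ ^ 2 :=
        add_le_add (mul_le_mul_of_nonneg_left hcosh1 (by positivity)) (mul_le_mul_of_nonneg_left hcosh2 ha)
    _ = (2 * d + a) * κ ^ 2 := by ring

end Defects

/-! ## §4 Dimock's Lemma 30 on the torus for `G_k = A₀⁻¹`, block-localised, and the UNIFORM EXPONENTIAL DECAY of
King's effective Laplacian `Δ^{(k)} = a − a²Q G_k Qᵀ` -/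

section Lemma30

variable {d : ℕ} (N : ℕ) [NeZero N] (M : Fin d → ℕ) [hM : ∀ μ, NeZero (M μ)]

open QGQInverse B4Sect5Torus

/-- The block sandwich `(Q A Qᵀ)(b,b′)` is the bilinear form of `A` between the two block rows of `Q`. [folklore] -/
theorem sandwich_apply_eq_dot (A : Matrix (Tor (fine N M)) (Tor (fine N M)) ℝ) (b b' : Tor M) :
    (Qmat N M * A * (Qmat N M)ᵀ) b b' = (fun x => Qmat N M b x) ⬝ᵥ (A *ᵥ fun x' => Qmat N M b' x') := by
  simp only [Matrix.mul_apply, Matrix.transpose_apply, dotProduct, Matrix.mulVec, Finset.sum_mul]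
  rw [Finset.sum_comm]
  refine Finset.sum_congr rfl fun x _ => ?_
  rw [Finset.mul_sum]
  exact Finset.sum_congr rfl fun x' _ => by ring

/-- Weighted `ℓ²` norm of a block row of `Q`: `Σ_x (g(x)Q(b,x))² = N^{−2d} Σ_{j} g(site b j)²`. [folklore] -/
theorem Qrow_weighted_sq (b : Tor M) (g : Tor (fine N M) → ℝ) :
    (fun x => g x * Qmat N M b x) ⬝ᵥ (fun x => g x * Qmat N M b x)
      = (((N : ℝ) ^ d)⁻¹) ^ 2 * ∑ j : Fin d → Fin N, g (site N M b j) ^ 2 := by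
  simp only [dotProduct]
  rw [← (blockEquiv N M).sum_comp, Fintype.sum_prod_type]
  have hterm : ∀ (b₁ : Tor M) (j : Fin d → Fin N),
      (g ((blockEquiv N M) (b₁, j)) * Qmat N M b ((blockEquiv N M) (b₁, j)))
        * (g ((blockEquiv N M) (b₁, j)) * Qmat N M b ((blockEquiv N M) (b₁, j)))
      = if b₁ = b then (((N : ℝ) ^ d)⁻¹) ^ 2 * g (site N M b₁ j) ^ 2 else 0 := by
    intro b₁ j
    simp only [blockEquiv_apply, Qmat, blockOf_site]
    split_ifs <;> ring
  rw [Finset.sum_congr rfl fun b₁ _ => Finset.sum_congr rfl fun j _ => hterm b₁ j, Finset.sum_comm]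
  simp only [Finset.sum_ite_eq', Finset.mem_univ, if_true]
  rw [Finset.mul_sum]

/-- The all-zero offset (a chosen point in each block). [folklore] -/
def j0 : Fin d → Fin N := fun _ => ⟨0, Nat.pos_of_ne_zero (NeZero.ne N)⟩

/-- **DIMOCK'S LEMMA 30 ON THE TORUS (block-to-block decay of `G_k = A₀⁻¹`), King's normalisation.**  For
`a > 0`, `m² ≥ 0`, `0 ≤ κ ≤ 1` with `(2d + a)κ² < γ_A` and all blocks `b, b′` of the unit torus `Π ℤ/M_μ`:
`|(Q A₀⁻¹ Qᵀ)(b,b′)| ≤ (γ_A − (2d+a)κ²)⁻¹ · N^{−d} · e^{2κ} · e^{−κ·tdist(b,b′)}`, UNIFORMLY in `N = L^k`, the torus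
and `m²`.  (`N^{−d}Q A₀⁻¹Qᵀ = Q_kG_kQ_k^*/ (a_k… )` in King's weighted conventions: this is `⟨1_{B(b)}, G_k 1_{B(b′)}⟩`
up to normalisation — Dimock's `|⟨f, G_k(Ω)f′⟩| ≤ O(1)e^{−δ₀d(y,y′)}‖f‖₂‖f′‖₂` for block indicators.)
Proof = §1 with the weight `ctW` centred in block `b′`, coercivity §3 (Lemma 29) and the second-order defect §3b.
[cite: Dimock2013, App. D, Lemma 30 (\label{thirty}, (usher)/(usher1.5)), arXiv:1108.1335v2; King1986, (4.34) p.674 ("Theorem 3.3" = [Ba 4])] -/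
theorem fineOp_inv_sandwich_decay {a m2 κ : ℝ} (ha : 0 < a) (hm : 0 ≤ m2) (hκ0 : 0 ≤ κ) (hκ1 : κ ≤ 1)
    (hρ : (2 * d + a) * κ ^ 2 < gamA a d) (b b' : Tor M) :
    |(Qmat N M * (fineOp N M a ((N : ℝ) ^ 2) m2)⁻¹ * (Qmat N M)ᵀ) b b'|
      ≤ (gamA a d - (2 * d + a) * κ ^ 2)⁻¹ * ((N : ℝ) ^ d)⁻¹ * Real.exp (2 * κ)
        * Real.exp (-(κ * tdistT M b b')) := by
  have hN1 : 1 ≤ N := Nat.one_le_iff_ne_zero.mpr (NeZero.ne N)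
  have hNpos : (0 : ℝ) < N := by exact_mod_cast (show 0 < N by omega)
  have hNd : (0 : ℝ) < (N : ℝ) ^ d := by positivity
  set x₀ : Tor (fine N M) := site N M b' (j0 N) with hx₀
  set f : Tor (fine N M) → ℝ := ctW N M κ x₀ with hf
  set t : ℝ := tdistT M b b' with ht
  have hS : ∀ x x', fineOp N M a ((N : ℝ) ^ 2) m2 x' x = fineOp N M a ((N : ℝ) ^ 2) m2 x x' := by
    intro x x'
    have h := congrFun (congrFun (fineOp_transpose N M a ((N : ℝ) ^ 2) m2) x) x'
    rwa [Matrix.transpose_apply] at h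
  have hSc := fineOp_coercive_unif N M hN1 ha.le hm
  have hrow := fineOp_coshRow_le N M ha.le hm hκ0 hκ1 x₀
  have hρ0 : 0 ≤ (2 * d + a) * κ ^ 2 := by positivity
  rw [sandwich_apply_eq_dot]
  have h := abs_dot_inv_le_of_conj (fineOp N M a ((N : ℝ) ^ 2) m2) hS f hρ0 hρ hSc hrow
    (fun x => Qmat N M b x) (fun x' => Qmat N M b' x')
  refine h.trans ?_
  -- the two weighted norms
  have hv : (fun x => Real.exp (-f x) * Qmat N M b x) ⬝ᵥ (fun x => Real.exp (-f x) * Qmat N M b x)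
      ≤ ((N : ℝ) ^ d)⁻¹ * (Real.exp (2 * κ) * Real.exp (-(2 * κ * t))) := by
    rw [Qrow_weighted_sq N M b (fun x => Real.exp (-f x))]
    have hj : ∀ j : Fin d → Fin N,
        Real.exp (-f (site N M b j)) ^ 2 ≤ Real.exp (2 * κ) * Real.exp (-(2 * κ * t)) := by
      intro j
      rw [← Real.exp_nat_mul, ← Real.exp_add]
      apply Real.exp_le_exp.mpr
      have hblk := mul_tdistT_blocks_le N M b b' j (j0 N)
      have hfx : f (site N M b j) = κ / N * tdistT (fine N M) (site N M b j) x₀ := rfl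
      have hge : κ * t - κ ≤ f (site N M b j) := by
        rw [hfx, ht]
        have h1 : κ / N * ((N : ℝ) * tdistT M b b' - ((N : ℝ) - 1))
            ≤ κ / N * tdistT (fine N M) (site N M b j) x₀ :=
          mul_le_mul_of_nonneg_left (by rw [hx₀]; linarith) (by positivity)
        have h2 : κ / N * ((N : ℝ) * tdistT M b b' - ((N : ℝ) - 1)) = κ * tdistT M b b' - κ + κ / N := by
          field_simp
          ring
        have h3 : 0 ≤ κ / N := by positivity
        linarith
      push_cast
      linarith
    calc (((N : ℝ) ^ d)⁻¹) ^ 2 * ∑ j : Fin d → Fin N, Real.exp (-f (site N M b j)) ^ 2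
        ≤ (((N : ℝ) ^ d)⁻¹) ^ 2 * ∑ _j : Fin d → Fin N, Real.exp (2 * κ) * Real.exp (-(2 * κ * t)) :=
          mul_le_mul_of_nonneg_left (Finset.sum_le_sum fun j _ => hj j) (by positivity)
      _ = ((N : ℝ) ^ d)⁻¹ * (Real.exp (2 * κ) * Real.exp (-(2 * κ * t))) := by
          simp only [Finset.sum_const, Finset.card_univ, Fintype.card_fun, Fintype.card_fin, nsmul_eq_mul]
          push_cast
          field_simp
  have hw : (fun x => Real.exp (f x) * Qmat N M b' x) ⬝ᵥ (fun x => Real.exp (f x) * Qmat N M b' x)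
      ≤ ((N : ℝ) ^ d)⁻¹ * Real.exp (2 * κ) := by
    rw [Qrow_weighted_sq N M b' (fun x => Real.exp (f x))]
    have hj : ∀ j : Fin d → Fin N, Real.exp (f (site N M b' j)) ^ 2 ≤ Real.exp (2 * κ) := by
      intro j
      rw [← Real.exp_nat_mul]
      apply Real.exp_le_exp.mpr
      have hfx : f (site N M b' j) = κ / N * tdistT (fine N M) (site N M b' j) x₀ := rfl
      have hle : f (site N M b' j) ≤ κ := by
        rw [hfx, hx₀]
        calc κ / N * tdistT (fine N M) (site N M b' j) (site N M b' (j0 N))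
            ≤ κ / N * ((N : ℝ) - 1) :=
              mul_le_mul_of_nonneg_left (tdistT_site_site_le N M b' j (j0 N)) (by positivity)
          _ = κ - κ / N := by field_simp
          _ ≤ κ := by linarith [div_nonneg hκ0 hNpos.le]
      push_cast
      linarith
    calc (((N : ℝ) ^ d)⁻¹) ^ 2 * ∑ j : Fin d → Fin N, Real.exp (f (site N M b' j)) ^ 2
        ≤ (((N : ℝ) ^ d)⁻¹) ^ 2 * ∑ _j : Fin d → Fin N, Real.exp (2 * κ) :=
          mul_le_mul_of_nonneg_left (Finset.sum_le_sum fun j _ => hj j) (by positivity)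
      _ = ((N : ℝ) ^ d)⁻¹ * Real.exp (2 * κ) := by
          simp only [Finset.sum_const, Finset.card_univ, Fintype.card_fun, Fintype.card_fin, nsmul_eq_mul]
          push_cast
          field_simp
  -- combine the square roots
  have hvnn : 0 ≤ (fun x => Real.exp (-f x) * Qmat N M b x) ⬝ᵥ (fun x => Real.exp (-f x) * Qmat N M b x) :=
    Literature.LinearAlgebra.Matrix.dotProduct_self_nonneg_real _
  have hprod : Real.sqrt ((fun x => Real.exp (-f x) * Qmat N M b x) ⬝ᵥ (fun x => Real.exp (-f x) * Qmat N M b x))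
      * Real.sqrt ((fun x => Real.exp (f x) * Qmat N M b' x) ⬝ᵥ (fun x => Real.exp (f x) * Qmat N M b' x))
      ≤ ((N : ℝ) ^ d)⁻¹ * Real.exp (2 * κ) * Real.exp (-(κ * t)) := by
    rw [← Real.sqrt_mul hvnn]
    have hXY : ((fun x => Real.exp (-f x) * Qmat N M b x) ⬝ᵥ (fun x => Real.exp (-f x) * Qmat N M b x))
        * ((fun x => Real.exp (f x) * Qmat N M b' x) ⬝ᵥ (fun x => Real.exp (f x) * Qmat N M b' x))
        ≤ (((N : ℝ) ^ d)⁻¹ * Real.exp (2 * κ) * Real.exp (-(κ * t))) ^ 2 := by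
      have e2 : Real.exp (-(κ * t)) ^ 2 = Real.exp (-(2 * κ * t)) := by
        rw [sq, ← Real.exp_add]
        congr 1
        ring
      have e : (((N : ℝ) ^ d)⁻¹ * Real.exp (2 * κ) * Real.exp (-(κ * t))) ^ 2
          = (((N : ℝ) ^ d)⁻¹ * (Real.exp (2 * κ) * Real.exp (-(2 * κ * t)))) * (((N : ℝ) ^ d)⁻¹ * Real.exp (2 * κ)) := by
        rw [mul_pow, mul_pow, e2]
        ring
      rw [e]
      exact mul_le_mul hv hw (Literature.LinearAlgebra.Matrix.dotProduct_self_nonneg_real _) (by positivity)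
    calc Real.sqrt _ ≤ Real.sqrt ((((N : ℝ) ^ d)⁻¹ * Real.exp (2 * κ) * Real.exp (-(κ * t))) ^ 2) :=
          Real.sqrt_le_sqrt hXY
      _ = ((N : ℝ) ^ d)⁻¹ * Real.exp (2 * κ) * Real.exp (-(κ * t)) := Real.sqrt_sq (by positivity)
  have hγρ : 0 < (gamA a d - (2 * d + a) * κ ^ 2)⁻¹ := inv_pos.mpr (sub_pos.mpr hρ)
  calc (gamA a d - (2 * ↑d + a) * κ ^ 2)⁻¹
        * Real.sqrt ((fun x => Real.exp (-f x) * Qmat N M b x) ⬝ᵥ (fun x => Real.exp (-f x) * Qmat N M b x))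
        * Real.sqrt ((fun x => Real.exp (f x) * Qmat N M b' x) ⬝ᵥ (fun x => Real.exp (f x) * Qmat N M b' x))
      = (gamA a d - (2 * ↑d + a) * κ ^ 2)⁻¹
        * (Real.sqrt ((fun x => Real.exp (-f x) * Qmat N M b x) ⬝ᵥ (fun x => Real.exp (-f x) * Qmat N M b x))
          * Real.sqrt ((fun x => Real.exp (f x) * Qmat N M b' x) ⬝ᵥ (fun x => Real.exp (f x) * Qmat N M b' x))) := by
        ring
    _ ≤ (gamA a d - (2 * ↑d + a) * κ ^ 2)⁻¹ * (((N : ℝ) ^ d)⁻¹ * Real.exp (2 * κ) * Real.exp (-(κ * t))) :=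
        mul_le_mul_of_nonneg_left hprod hγρ.le
    _ = _ := by ring

/-- **UNIFORM EXPONENTIAL DECAY OF KING'S EFFECTIVE LAPLACIAN** — the input *"Δ^{(k)} has uniform exponential
decay (see Theorem 3.3)"* of Lemma 4.5 (p.674, (4.34)(ii)), PROVED for the A = 0 operators on every torus: for
`a > 0`, `m² > 0`, `0 ≤ κ ≤ 1`, `(2d + a)κ² < γ_A`, all `N = L^k ≥ 1`, all tori `Π ℤ/M_μ` and all `b, b′`,
`|Δ^{(k)}(b,b′)| ≤ (a + a²(γ_A − (2d+a)κ²)⁻¹e^{2κ}) · e^{−κ·tdist(b,b′)}`.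
[cite: King1986, (2.14) p.653, (4.34) p.674; Dimock2013, App. D, Lemma 30 + (Cbound)] -/
theorem effLaplacian_entry_le {a m2 κ : ℝ} (ha : 0 < a) (hm : 0 < m2) (hκ0 : 0 ≤ κ) (hκ1 : κ ≤ 1)
    (hρ : (2 * d + a) * κ ^ 2 < gamA a d) (b b' : Tor M) :
    |effLaplacian N M a ((N : ℝ) ^ 2) m2 b b'|
      ≤ (a + a ^ 2 * (gamA a d - (2 * d + a) * κ ^ 2)⁻¹ * Real.exp (2 * κ))
        * Real.exp (-(κ * tdistT M b b')) := by
  have hNd : (0 : ℝ) < (N : ℝ) ^ d := by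
    have : (0 : ℝ) < N := by exact_mod_cast Nat.pos_of_ne_zero (NeZero.ne N)
    positivity
  have hsand := fineOp_inv_sandwich_decay N M ha hm.le hκ0 hκ1 hρ b b'
  have hdiag : |a * (1 : Matrix (Tor M) (Tor M) ℝ) b b'| ≤ a * Real.exp (-(κ * tdistT M b b')) := by
    by_cases hb : b = b'
    · subst hb
      rw [Matrix.one_apply_eq, tdistT_self, mul_zero, neg_zero, Real.exp_zero, abs_of_nonneg (by positivity)]
    · rw [Matrix.one_apply_ne hb, mul_zero, abs_zero]
      positivity
  rw [effLaplacian, Matrix.sub_apply, Matrix.smul_apply, Matrix.smul_apply, smul_eq_mul, smul_eq_mul]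
  calc |a * (1 : Matrix (Tor M) (Tor M) ℝ) b b'
        - a ^ 2 * (N : ℝ) ^ d * (Qmat N M * (fineOp N M a ((N : ℝ) ^ 2) m2)⁻¹ * (Qmat N M)ᵀ) b b'|
      ≤ |a * (1 : Matrix (Tor M) (Tor M) ℝ) b b'|
        + |a ^ 2 * (N : ℝ) ^ d * (Qmat N M * (fineOp N M a ((N : ℝ) ^ 2) m2)⁻¹ * (Qmat N M)ᵀ) b b'| :=
        abs_sub _ _
    _ ≤ a * Real.exp (-(κ * tdistT M b b'))
        + a ^ 2 * (N : ℝ) ^ d * ((gamA a d - (2 * d + a) * κ ^ 2)⁻¹ * ((N : ℝ) ^ d)⁻¹ * Real.exp (2 * κ)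
          * Real.exp (-(κ * tdistT M b b'))) := by
        refine add_le_add hdiag ?_
        rw [abs_mul, abs_of_nonneg (by positivity : (0 : ℝ) ≤ a ^ 2 * (N : ℝ) ^ d)]
        exact mul_le_mul_of_nonneg_left hsand (by positivity)
    _ = _ := by field_simp

/-- **The decay RATE `κ_A` of `Δ^{(k)}`**: `κ_A = min(1, √(γ_A/(2(2d+a))))`, so that `(2d+a)κ_A² ≤ γ_A/2`. [folklore] -/
def kapA (a : ℝ) (dd : ℕ) : ℝ := min 1 (Real.sqrt (gamA a dd / (2 * (2 * dd + a))))

/-- **The decay CONSTANT `C_Δ` of `Δ^{(k)}`**: `C_Δ = a + a²·(2/γ_A)·e²`. [folklore] -/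
def CDelta (a : ℝ) (dd : ℕ) : ℝ := a + a ^ 2 * (2 / gamA a dd) * Real.exp 2

/-- `0 < κ_A`. [folklore] -/
theorem kapA_pos {a : ℝ} (ha : 0 < a) (dd : ℕ) : 0 < kapA a dd := by
  unfold kapA
  refine lt_min one_pos (Real.sqrt_pos.mpr ?_)
  have := gamA_pos ha dd
  positivity

/-- `κ_A ≤ 1`. [folklore] -/
theorem kapA_le_one (a : ℝ) (dd : ℕ) : kapA a dd ≤ 1 := min_le_left _ _

/-- `(2d + a)κ_A² ≤ γ_A/2`. [folklore] -/
theorem rho_kapA_le {a : ℝ} (ha : 0 < a) (dd : ℕ) : (2 * dd + a) * kapA a dd ^ 2 ≤ gamA a dd / 2 := by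
  have hγ := gamA_pos ha dd
  have hpos : 0 < 2 * (2 * (dd : ℝ) + a) := by positivity
  have h1 : kapA a dd ^ 2 ≤ gamA a dd / (2 * (2 * dd + a)) := by
    have hk0 : 0 ≤ kapA a dd := (kapA_pos ha dd).le
    calc kapA a dd ^ 2 ≤ Real.sqrt (gamA a dd / (2 * (2 * dd + a))) ^ 2 :=
          pow_le_pow_left₀ hk0 (min_le_right _ _) 2
      _ = gamA a dd / (2 * (2 * dd + a)) := Real.sq_sqrt (by positivity)
  calc (2 * dd + a) * kapA a dd ^ 2 ≤ (2 * dd + a) * (gamA a dd / (2 * (2 * dd + a))) :=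
        mul_le_mul_of_nonneg_left h1 (by positivity)
    _ = gamA a dd / 2 := by field_simp

/-- `0 < C_Δ`. [folklore] -/
theorem CDelta_pos {a : ℝ} (ha : 0 < a) (dd : ℕ) : 0 < CDelta a dd := by
  unfold CDelta
  have := gamA_pos ha dd
  positivity

/-- **KING'S (4.34)(ii) / "UNIFORM EXPONENTIAL DECAY OF Δ^{(k)}" AS A THEOREM, explicit constants**: for every
`a > 0`, `m² > 0`, every `N = L^k ≥ 1` and every torus, `|Δ^{(k)}(b,b′)| ≤ C_Δ(a,d)·e^{−κ_A(a,d)·tdist(b,b′)}` with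
`C_Δ`, `κ_A` depending on `a` and `d` ONLY (not on `k`, the volume or the mass).  Scope: A = 0, periodic boundary
conditions, flat block profile — exactly King's §4 setting; the free-boundary-condition/reflection transport of
[Ba 4] and the background dependence are not formalised.
[cite: King1986, (4.34) p.674, Theorem 3.3 (3.6) p.655; Dimock2013, App. D, Lemmas 29–30] -/
theorem effLaplacian_decay {a m2 : ℝ} (ha : 0 < a) (hm : 0 < m2) (b b' : Tor M) :
    |effLaplacian N M a ((N : ℝ) ^ 2) m2 b b'| ≤ CDelta a d * Real.exp (-(kapA a d * tdistT M b b')) := by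
  have hγ := gamA_pos ha d
  have hρle := rho_kapA_le ha d
  have hρ : (2 * d + a) * kapA a d ^ 2 < gamA a d := by linarith
  have h := effLaplacian_entry_le N M ha hm (kapA_pos ha d).le (kapA_le_one a d) hρ b b'
  refine h.trans (mul_le_mul_of_nonneg_right ?_ (Real.exp_pos _).le)
  unfold CDelta
  have h1 : (gamA a d - (2 * d + a) * kapA a d ^ 2)⁻¹ ≤ 2 / gamA a d := by
    rw [div_eq_mul_inv, show (2 : ℝ) * (gamA a d)⁻¹ = (gamA a d / 2)⁻¹ by rw [inv_div]; ring]
    exact inv_anti₀ (by positivity) (by linarith)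
  have h2 : Real.exp (2 * kapA a d) ≤ Real.exp 2 :=
    Real.exp_le_exp.mpr (by linarith [kapA_le_one a d])
  have h3 : 0 ≤ (gamA a d - (2 * d + a) * kapA a d ^ 2)⁻¹ := inv_nonneg.mpr (by linarith)
  gcongr

end Lemma30



end Torus

end Literature.MathematicalPhysics.QuantumFieldTheory.King1986

end
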